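import Literature.ModelTheory.ExponentialFields.Languages
import Literature.NumberTheory.Transcendental.ExpVarieties
import Summits.Schanuel.Schanuel.Theorems.ZilberEacComplexQuadricCover
import HarnessLib

/-!
# Quadric covers with imaginary leading root: the varieties and a model system

EC-vocabulary corollaries of `exists_expPoint_quadricCover` (`ZilberEacComplexQuadricCover.lean`;
first open rung of Exponential-Algebraic Closedness, Mantova–Masser, PLMS 129 (2024), §1 p. 5):

* `exists_solution_quadricCover`, `quadricCover_inter_expGraph_nonempty` — the `(s+1)`-fold
  `V = {xₙ² = P(x'), yⱼ = Aⱼ(x') + yₙ Fⱼ(yₙ)}` meets `Literature.NumberTheory.Transcendental.expGraph`;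
* `hyperboloid_model_system_solvable` — `∃ z w t, t² = z² + w² + 1 ∧ e^z = z + e^t ∧ e^w = w - e^t`
  (base `x₃² = x₁² + x₂² + 1`: `P₂(2πi q) = -4π²|q|² < 0` for every `q`, outside the cyclic-cover
  theorem; the sphere `Σ xᵢ² = r` is the same quadric up to `x₃ ↦ i x₃`, which is not an
  automorphism of the exponential-algebraic structure).

HONEST FRAMING: a modest new sub-rung of EAC; nothing here bears on Schanuel's conjecture.
-/

noncomputable section

open Complex MvPolynomial Metric Set Filter Topology

set_option linter.dupNamespace false

namespace Summit.Schanuel.Schanuel.Theorems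

/-- **Solvability** (plain form of `exists_expPoint_quadricCover`): some `x'`, `xₙ` with
`xₙ² = P(x')` and `exp xⱼ = Aⱼ(x') + e^{xₙ} Fⱼ(e^{xₙ})`. [cite: MantovaMasser2023, §1 p.5 (the open case dim π(V) = 2 in ℂ³×ℂˣ³)] -/
theorem exists_solution_quadricCover {s : ℕ} (P : MvPolynomial (Fin s) ℂ) (hP2 : P.totalDegree = 2)
    (q : Fin s → ℤ)
    (hbim : (eval (fun j => 2 * Real.pi * I * (q j : ℂ)) (homogeneousComponent 2 P)).im = 0)
    (hbre : (eval (fun j => 2 * Real.pi * I * (q j : ℂ)) (homogeneousComponent 2 P)).re < 0)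
    (A : Fin s → MvPolynomial (Fin s) ℂ)
    (hA : ∀ j, eval (fun i => 2 * Real.pi * I * (q i : ℂ))
      (homogeneousComponent (A j).totalDegree (A j)) ≠ 0)
    (hlam : ∑ j, ((A j).totalDegree : ℝ) * (eval (fun i => 2 * Real.pi * I * (q i : ℂ))
      (pderiv j (homogeneousComponent 2 P))).im ≠ 0)
    (F : Fin s → Polynomial ℂ) :
    ∃ x : Fin s → ℂ, ∃ xn : ℂ, xn ^ 2 = eval x P ∧
      ∀ j, exp (x j) = eval x (A j) + exp xn * (F j).eval (exp xn) := by
  obtain ⟨m, x, xn, -, hxn, hx⟩ := (exists_expPoint_quadricCover P hP2 q hbim hbre A hA hlam F).exists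
  exact ⟨x, xn, hxn, hx⟩

/-- **The quadric-cover varieties meet the graph of exponentiation** (EC vocabulary): with
`n = s + 1`, under the hypotheses of `exists_expPoint_quadricCover` the subvariety
`V = {xₙ² = P(x₁..xₛ), yⱼ = Aⱼ(x₁..xₛ) + yₙ Fⱼ(yₙ) (j ≤ s)}` of `ℂⁿ × ℂⁿ` (distinguished last
coordinate `Fin.last s`) contains a point of `Literature.NumberTheory.Transcendental.expGraph ℂ n`,
hence of `ℂⁿ × (ℂˣ)ⁿ`. Its additive projection is the quadric `xₙ² = P(x')` (dimension `n - 1`).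
[cite: MantovaMasser2023, §1 p.5 (the open case dim π(V) = 2 in ℂ³×ℂˣ³)] -/
theorem quadricCover_inter_expGraph_nonempty {s : ℕ} (P : MvPolynomial (Fin s) ℂ)
    (hP2 : P.totalDegree = 2) (q : Fin s → ℤ)
    (hbim : (eval (fun j => 2 * Real.pi * I * (q j : ℂ)) (homogeneousComponent 2 P)).im = 0)
    (hbre : (eval (fun j => 2 * Real.pi * I * (q j : ℂ)) (homogeneousComponent 2 P)).re < 0)
    (A : Fin s → MvPolynomial (Fin s) ℂ)
    (hA : ∀ j, eval (fun i => 2 * Real.pi * I * (q i : ℂ))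
      (homogeneousComponent (A j).totalDegree (A j)) ≠ 0)
    (hlam : ∑ j, ((A j).totalDegree : ℝ) * (eval (fun i => 2 * Real.pi * I * (q i : ℂ))
      (pderiv j (homogeneousComponent 2 P))).im ≠ 0)
    (F : Fin s → Polynomial ℂ) :
    ({z : Fin (s + 1) ⊕ Fin (s + 1) → ℂ |
        z (Sum.inl (Fin.last s)) ^ 2 = eval (fun j => z (Sum.inl (Fin.castSucc j))) P ∧
        ∀ j : Fin s, z (Sum.inr (Fin.castSucc j)) =
          eval (fun i => z (Sum.inl (Fin.castSucc i))) (A j) +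
            z (Sum.inr (Fin.last s)) * (F j).eval (z (Sum.inr (Fin.last s)))} ∩
      Literature.NumberTheory.Transcendental.expGraph ℂ (s + 1)).Nonempty := by
  obtain ⟨x, xn, hxn, hx⟩ := exists_solution_quadricCover P hP2 q hbim hbre A hA hlam F
  set X : Fin (s + 1) → ℂ := Fin.snoc x xn with hX
  refine ⟨Sum.elim X fun i => exp (X i), ⟨?_, fun j => ?_⟩, fun i => ?_⟩
  · simp only [Sum.elim_inl, hX, Fin.snoc_last, Fin.snoc_castSucc]
    exact hxn
  · simp only [Sum.elim_inl, Sum.elim_inr, hX, Fin.snoc_castSucc, Fin.snoc_last]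
    exact hx j
  · simp [Literature.ModelTheory.ExponentialFields.ExponentialRing.complex_exp_eq]


/-- **A hyperboloid model system is solvable**: there are `z, w, t ∈ ℂ` with
`t² = z² + w² + 1`, `e^z = z + e^t` and `e^w = w - e^t` — an exponential point of the 3-fold
`V = {x₃² = x₁² + x₂² + 1, y₁ = x₁ + y₃, y₂ = x₂ - y₃} ⊆ ℂ³ × (ℂˣ)³`, whose additive projection
`x₃² = x₁² + x₂² + 1` has `P₂(2πi q) = -4π²(q₁² + q₂²) < 0` for every `q ≠ 0` (no direction for
the cyclic-cover theorem; the complex sphere `x₁² + x₂² + x₃² = r` is the same quadric up to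
`x₃ ↦ i x₃`, which is not an automorphism of the exponential-algebraic structure). Here
`q = (1,1)`, `λ = Im ∂₁P₂(2πi q) + Im ∂₂P₂(2πi q) = 8π ≠ 0`. New.
[cite: MantovaMasser2023, §1 p.5 (the open case dim π(V) = 2 in ℂ³×ℂˣ³)] -/
theorem hyperboloid_model_system_solvable :
    ∃ z w t : ℂ, t ^ 2 = z ^ 2 + w ^ 2 + 1 ∧ exp z = z + exp t ∧ exp w = w - exp t := by
  set S2 : MvPolynomial (Fin 2) ℂ := X 0 ^ 2 + X 1 ^ 2 with hS2
  set P : MvPolynomial (Fin 2) ℂ := S2 + C 1 with hP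
  have hS2hom : S2.IsHomogeneous 2 := (isHomogeneous_X_pow 0 2).add (isHomogeneous_X_pow 1 2)
  have hS2eval : ∀ x : Fin 2 → ℂ, eval x S2 = x 0 ^ 2 + x 1 ^ 2 := fun x => by
    simp [hS2, map_add, map_pow, eval_X]
  have hPeval : ∀ x : Fin 2 → ℂ, eval x P = x 0 ^ 2 + x 1 ^ 2 + 1 := fun x => by
    rw [hP, map_add, hS2eval, eval_C]
  have hS2ne : S2 ≠ 0 := by
    intro h0
    have := hS2eval ![1, 0]
    rw [h0, map_zero] at this
    norm_num at this
  have hdegS2 : S2.totalDegree = 2 := hS2hom.totalDegree hS2ne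
  have hP2 : P.totalDegree = 2 := by
    rw [hP, totalDegree_add_eq_left_of_totalDegree_lt] <;> rw [hdegS2]
    rw [totalDegree_C]; norm_num
  have hPtop : homogeneousComponent 2 P = S2 := by
    rw [hP, map_add, homogeneousComponent_eq_self hS2hom,
      homogeneousComponent_of_mem (isHomogeneous_C _ (1 : ℂ))]
    simp
  set q : Fin 2 → ℤ := ![1, 1] with hq
  have hv : (fun j : Fin 2 => 2 * (Real.pi : ℂ) * I * ((q j : ℤ) : ℂ)) = fun _ => 2 * Real.pi * I := by
    funext j; fin_cases j <;> simp [hq]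
  have hS2v : eval (fun _ : Fin 2 => 2 * (Real.pi : ℂ) * I) S2 = ((-8 * Real.pi ^ 2 : ℝ) : ℂ) := by
    have h2piI : (2 * (Real.pi : ℂ) * I) ^ 2 = ((-4 * Real.pi ^ 2 : ℝ) : ℂ) := by
      push_cast
      ring_nf
      rw [Complex.I_sq]
      ring
    rw [hS2eval, h2piI]; push_cast; ring
  have hbim : (eval (fun j : Fin 2 => 2 * Real.pi * I * ((q j : ℤ) : ℂ)) (homogeneousComponent 2 P)).im = 0 := by
    rw [hv, hPtop, hS2v, Complex.ofReal_im]
  have hbre : (eval (fun j : Fin 2 => 2 * Real.pi * I * ((q j : ℤ) : ℂ)) (homogeneousComponent 2 P)).re < 0 := by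
    rw [hv, hPtop, hS2v, Complex.ofReal_re]
    have := Real.pi_pos; nlinarith
  set A : Fin 2 → MvPolynomial (Fin 2) ℂ := ![X 0, X 1] with hAdef
  have hA0 : A 0 = X 0 := by simp [hAdef]
  have hA1 : A 1 = X 1 := by simp [hAdef]
  have hdegA0 : (A 0).totalDegree = 1 := by rw [hA0, totalDegree_X]
  have hdegA1 : (A 1).totalDegree = 1 := by rw [hA1, totalDegree_X]
  have hpi : (2 * (Real.pi : ℂ) * I) ≠ 0 := by
    have := Real.pi_pos
    simp [Complex.ext_iff, this.ne']
  have hA : ∀ j, eval (fun i : Fin 2 => 2 * Real.pi * I * ((q i : ℤ) : ℂ))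
      (homogeneousComponent (A j).totalDegree (A j)) ≠ 0 := by
    rw [hv]
    refine Fin.forall_fin_two.mpr ⟨?_, ?_⟩
    · rw [hdegA0, hA0, homogeneousComponent_eq_self (isHomogeneous_X ℂ 0), eval_X]; exact hpi
    · rw [hdegA1, hA1, homogeneousComponent_eq_self (isHomogeneous_X ℂ 1), eval_X]; exact hpi
  have hpd0 : eval (fun _ : Fin 2 => 2 * (Real.pi : ℂ) * I) (pderiv 0 S2) = 2 * (2 * Real.pi * I) := by
    have h : pderiv 0 S2 = 2 * X 0 := by
      rw [hS2, map_add, pderiv_pow, pderiv_pow, pderiv_X_self,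
        pderiv_X_of_ne (show (1 : Fin 2) ≠ 0 by decide)]
      simp
    rw [h, map_mul, eval_X]; simp
  have hpd1 : eval (fun _ : Fin 2 => 2 * (Real.pi : ℂ) * I) (pderiv 1 S2) = 2 * (2 * Real.pi * I) := by
    have h : pderiv 1 S2 = 2 * X 1 := by
      rw [hS2, map_add, pderiv_pow, pderiv_pow, pderiv_X_self,
        pderiv_X_of_ne (show (0 : Fin 2) ≠ 1 by decide)]
      simp
    rw [h, map_mul, eval_X]; simp
  have him4 : ((2 : ℂ) * (2 * Real.pi * I)).im = 4 * Real.pi := by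
    simp; ring
  have hlam : ∑ j, ((A j).totalDegree : ℝ) * (eval (fun i : Fin 2 => 2 * Real.pi * I * ((q i : ℤ) : ℂ))
      (pderiv j (homogeneousComponent 2 P))).im ≠ 0 := by
    rw [hv, hPtop, Fin.sum_univ_two, hdegA0, hdegA1, hpd0, hpd1, him4]
    have := Real.pi_pos
    push_cast
    nlinarith
  obtain ⟨x, xn, hxn, hx⟩ := exists_solution_quadricCover P hP2 q hbim hbre A hA hlam
    ![Polynomial.C 1, Polynomial.C (-1)]
  refine ⟨x 0, x 1, xn, ?_, ?_, ?_⟩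
  · rw [hxn, hPeval]
  · have h := hx 0
    rw [hA0, eval_X] at h
    simp only [Matrix.cons_val_zero, Polynomial.eval_C, mul_one] at h
    exact h
  · have h := hx 1
    rw [hA1, eval_X] at h
    simp only [Matrix.cons_val_one, Matrix.cons_val_fin_one, Polynomial.eval_C, mul_neg, mul_one] at h
    rw [h]; ring

end Summit.Schanuel.Schanuel.Theorems
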